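import Summits.BirchSwinnertonDyer.Rank1Residual.Additive.TameBranchGrossZagier
import Summits.BirchSwinnertonDyer.Rank1Residual.Additive.TameBranchKatoDivisibilityOfDelbourgo
import HarnessLib

/-!
# Row B6 (O7-ord), defect 3/4/6: the CELL THEOREM "tame-branch `p`-adic Gross–Zagier for Delbourgo's
# datum" (PROOF-gz2 Thm. 2 ∘ Delbourgo 2002 (B)) as ONE DISPLAYED named `Prop`, and the rank-one LOWER
# half of BSD_p on CellGordHigher from PRINT + that `Prop` + one certified tame branch
# (cell `bsd-addord`, FULL-BSD rank-≤ 1 programme D-0033 tranche 1a, seat `bsd-addord-gz`, session 3;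
# planner rulings R-O7′ / R-O7″ (2)(3), `run/shared/lean/pub/bsd-addord/TARGET.md` §8)

HONEST FRAMING. ONE definition (a bare `Prop`, NOTHING ASSERTED, no `_holds`) and theorems; no
`sorry`; nothing booked; labels of the residual map UNCHANGED. The definition
`tameBranch_delbourgoDatum_rankOne_leadingTerms` says: on the potentially good ORDINARY additive
locus of tame defect `e ∈ {3,4,6}` (`p ≥ 5`, `E` non-CM, `r_an(E) = 1`) ONE height datum `Dh` — in the
memo: Delbourgo's `⟨,⟩_{p,ℚ}` — satisfies BOTH Delbourgo 2002 Thm. (B)'s clauses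
(`LeadingTermClauses W p Dh`, PRINTED) AND the typed tame-branch `p`-adic Gross–Zagier formula
`TameBranchPAdicGrossZagierAt W p Dh` (§0 of `TameBranchGrossZagier.lean`). Its second half is NOT in
print: it is the CELL THEOREM PROOF-gz2.md Thm. 2 / Cor. 2′ (text of record sha256 813e215bedde3df0…,
archived under `run/shared/lean/pub/bsd-addord/frozen/`), proved on paper from Disegni, Compos. Math.
153 (2017) Thm. B at `(E, 𝟙_K)` with RAMIFIED unit character, Tunnell–Saito multiplicity one, the
uniform Gauss-sum recipe on a ramified branch and the Perrin-Riou calibration; cross-family referee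
verdict **REF-gz2: PASS — Thm. 2, Cor. 2′ (Cor. 3′ as READING) — with CONDITION GZ-H2**
(`run/shared/lean/pub/bsd-addord/REF-gz2.md`, 2026-08-25; independent STEP-0 re-run kit j241302). The
universal quantification over tuples inside `TameBranchPAdicGrossZagierAt` is harmless by the tree's
tuple rigidity (`IsTameBranchOf.eq_zero_or_tuple_eq`, granted one non-zero branch — Rohrlich) — REF-gz2
note 3. This is the defect-3/4/6 twin of the defect-2 Literature fact
`Disegni2017.delbourgoDatum_rankOne_leadingTerms` (p402187; V-currency); it lives Summits-side because
its vocabulary (`IsTameBranchOf`, `TameBranchPAdicGrossZagierAt`, `TypeGOrd`) is Summits-side. The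
planner's R-O7″ (2) deferred any fact at `e ∈ {3,4,6}` "until a v2 is scored"; PROOF-gz2 IS that text
and is scored. Every consumer DISPLAYS `(hFact2 : tameBranch_delbourgoDatum_rankOne_leadingTerms)`.

CONDITION GZ-H2 (binding locator sentence, verbatim in substance, as in `TameBranchGrossZagier.lean`
§3): in PROOF-gz2 §3.3 (Lemma H′) the identification of the height of Disegni 2017 Thm. B at
`(E, 𝟙_K)` with Delbourgo's `h_p = ⟨,⟩_{p,ℚ}` (J. Number Theory 95 (2002) p. 39, `K = F_e`) is ROUTED
THROUGH the (n-exc)-CONDITIONAL printed sentence Disegni 2017 Rem. 1.3.2 (arXiv v3 PDF p. 9, L14–16)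
together with the absolute normalisation (4.1.7) `ℓ_w := [F′:F]⁻¹ ℓ_v ∘ N` (PDF p. 39), with (n-exc)
DISCHARGED because `α_p = ε̃·unr(a)` is RAMIFIED (PROOF-gz2 3.1 (iv)); the sentence's ultimate source,
Nekovář 1993 §§7–8 (and Mazur–Tate 1983 §4.4), is NOT HELD on the hub (acq-10827 open), so the
verification trail is Disegni 2017's printed statements (refereed corroboration at good ordinary:
Iovita–Werner 2003, Werner 1998). The memo's sign `u₀ = ±1` is numerical only; consumers are sign-blind.

## What

* §1 `tameBranch_delbourgoDatum_rankOne_leadingTerms` (the displayed `Prop`) and its projection.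
* §2 **The rank-one LOWER half on CellGordHigher from PRINT + the `Prop` + ONE certified tame branch**:
  `missingLowerBoundAt_rankOne_gordHigher_of_cellFact_of_thmC_of_cert` — Delbourgo 2002 (A)+(B)
  (`hDel`), (C) (`hC`, A227, via `tameBranchRatDvdAt_of_thmC`; `hDelM` rides in that discharge), GZK,
  the `Prop`, and per pair: a tame-branch tuple `(f, ε, α, B)` with `B` `p`-integral and
  `‖[T¹]B‖_p = 1`, the period index `ϖ` with `ord_p ϖ ≤ 0`, non-anomalous reduction, `#Ш_an = s` ⟹
  `Typed.MissingLowerBoundAt W p` — the HEADLINE of `TameBranchGrossZagier.lean` with its two height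
  binders (`hBcl`, `hGZ`) supplied by the `Prop` and its Kato half by print; class forms on
  X4♯(G-ord) / X3♯(G-ord).

## What is NOT claimed

Nothing asserted (a `Prop`); no booking; no UPPER half at defect `3,4,6` (it is a `μ`-statement —
PROOF-gz2 Cor. 3′ (c) — not in print); nothing at defect `2` (that is the Literature fact and
`TwistedBranchPAdicGrossZagier{,BSD,EndState}.lean`), at `p ≤ 3`, pot-supersingular `p`, rank `≠ 1`;
Schneider class-wide; the sign `u₀`; the tuple's existence is per pair here (from print it is
`TwistPartner.exists_isTameBranchOf_of_thm1`, Delbourgo 1998 Thm. 1, but the unit certificate is a number).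

References: [Delbourgo2002] Thm. (A), (B), (C) p. 40, `⟨,⟩_{p,ℚ}` p. 39; [Delbourgo1998] Thm. 1, §2.5;
[Disegni2017] Def. 1.2.2, Thm. B, Rem. 1.3.2, (4.1.7); [MazurTateTeitelbaum1986Invent] §I.10, §I.13–14;
[Miller2011LMS] Def. 1.1; cell memo PROOF-gz2.md §0 (T2), Cor. 2′, §3, §4; REF-gz2.md.
-/

set_option autoImplicit false

noncomputable section

open scoped Classical MatrixGroups ModularForm NumberField

open CongruenceSubgroup IsDedekindDomain WeierstrassCurve NumberField
  Literature.NumberTheory.EllipticCurves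
  Literature.NumberTheory.EllipticCurves.ModularForms
  Literature.NumberTheory.EllipticCurves.Rank1Residual
  Literature.NumberTheory.EllipticCurves.Rank1Residual.Typed
  Literature.NumberTheory.EllipticCurves.Delbourgo2002
  Summit.BirchSwinnertonDyer.Rank1Residual.AdditivePotMult
  Summit.BirchSwinnertonDyer.Rank1Residual.X1.MuLambda
  Summit.BirchSwinnertonDyer.Rank1Residual.X1.RankOneParitySqueeze
  Summit.BirchSwinnertonDyer.Rank1Residual.X11a.LambdaNorm

namespace Summit.BirchSwinnertonDyer.Rank1Residual.Additive

/-! ### §1 The cell theorem as ONE displayed `Prop` (nothing asserted) -/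

/-- **CELL THEOREM (PROOF-gz2 Thm. 2 / Cor. 2′ ∘ Delbourgo 2002 Thm. (B)), NOT IN PRINT, NOTHING
ASSERTED: tame-branch `p`-adic Gross–Zagier for Delbourgo's datum at an additive potentially good
ORDINARY prime of defect `3, 4, 6`.** For `W/ℚ` globally minimal WITHOUT CM, `p ≥ 5` a prime of
ADDITIVE reduction of type (G)-ordinary (`TypeGOrd W p`, Delbourgo's hypothesis (G) with unit root) and
tame defect `semistabilityIndex W p ≠ 2` (so `e ∈ {3,4,6}`; no semistable twist over `ℚ`), and
`ord_{s=1} L(E,s) = 1`: there is a `p`-adic height datum `Dh` on `E(ℚ)` — in print and in the memo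
Delbourgo's `⟨,⟩_{p,ℚ} = e⁻¹⟨,⟩^{Sch}_{p,F_e}` — satisfying (i) Delbourgo's Theorem (B) clauses
`LeadingTermClauses W p Dh` (PRINTED, J. Number Theory 95 (2002) p. 40) and (ii) the typed tame-branch
formula `TameBranchPAdicGrossZagierAt W p Dh`: for every tuple `(f, ε, α, B)` of the E-normalised
package and period index `ϖ`, `L′(E,1) = q·Ω_E·Reg_∞` and `ϖ·[T¹]B·log_p γ₀ = u·q·Reg_p(E,Dh)`,
`u ∈ ℤ_p^×` (memo (T2): `u = u₀a⁻¹`, `u₀ = ±1` universal, numerically `+1`). Source of (ii): the cell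
memo PROOF-gz2.md (sha256 813e215bedde3df0…), **REF-gz2: PASS with CONDITION GZ-H2** (module
docstring; Disegni 2017 Rem. 1.3.2 (n-exc)-conditional + (4.1.7); (n-exc) discharged by `α_p`
ramified; Nekovář 1993 unheld, acq-10827). NOT a theorem in print; NEVER cite it as one; consumers take
`(hFact2 : tameBranch_delbourgoDatum_rankOne_leadingTerms)` as an explicit hypothesis.
[cite: Delbourgo2002, Theorem (A), (B) (p. 40), ⟨,⟩_{p,ℚ} (p. 39)]
[cite: Disegni2017, Thm. B (§1.3.2), Def. 1.2.2, Rem. 1.3.2, §4.1 (4.1.7) (provenance; nothing asserted)]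
[cite: Delbourgo1998, Thm. 1 and §2.5 BS-D(p) (ii) (pp. 151–152) (shape)]
[cite: MazurTateTeitelbaum1986Invent, §I.10, §I.13–I.14 (shape)] -/
def tameBranch_delbourgoDatum_rankOne_leadingTerms : Prop :=
  ∀ (W : WeierstrassCurve ℚ) [W.IsElliptic] [W.IsGloballyMinimal] (p : ℕ) [Fact p.Prime],
    5 ≤ p → ¬ W.HasCM → Addv W p → TypeGOrd W p → semistabilityIndex W p ≠ 2 →
    W.analyticRank = 1 →
    ∃ Dh : PAdicHeightData W p, LeadingTermClauses W p Dh ∧ TameBranchPAdicGrossZagierAt W p Dh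

variable {W : WeierstrassCurve ℚ} [W.IsElliptic] [W.IsGloballyMinimal] {p : ℕ} [hp : Fact p.Prime]

/-- Projection: the datum with both clause sets. [cite: Delbourgo2002, Theorem (B) (p. 40)] -/
theorem tameBranch_delbourgoDatum_rankOne_leadingTerms.exists_datum
    (hFact2 : tameBranch_delbourgoDatum_rankOne_leadingTerms) (hp5 : 5 ≤ p) (hcm : ¬ W.HasCM)
    (hadd : Addv W p) (hG : TypeGOrd W p) (he : semistabilityIndex W p ≠ 2) (hr : W.analyticRank = 1) :
    ∃ Dh : PAdicHeightData W p, LeadingTermClauses W p Dh ∧ TameBranchPAdicGrossZagierAt W p Dh :=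
  hFact2 W p hp5 hcm hadd hG he hr

/-! ### §2 Rank one, defect 3/4/6: the LOWER half from PRINT + the `Prop` + ONE certified tame branch -/

/-- **CellGordHigher (additive, (G)-ordinary, defect `e ∈ {3,4,6}`), `p ≥ 5`, `E` non-CM, `r_an(E) = 1`,
non-anomalous: the LOWER half `ord_p #Ш_an(E) ≤ ord_p #Ш(E)` (`Typed.MissingLowerBoundAt W p`) from
PRINT + the displayed cell `Prop` + ONE certified tame branch.** Printed binders: Delbourgo 2002
(A)+(B) (`hDel`), (C) (`hC` = A227 `Delbourgo2002.thmC_charIdeal_dvd_tameBranch`, giving the typed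
Kato half `TameBranchRatDvdAt W p` through `tameBranchRatDvdAt_of_thmC`; `hDelM` is that discharge's
(M)-row binder, idle on these rows but part of its signature), GZK (`hGZK`). Displayed non-published
binder: `hFact2`. Per pair: a tuple `(f, ε, α, B)` with `IsTameBranchOf f p ε α B`, `B` `p`-integral
(`hint`) and `‖[T¹]B‖_p = 1` (`hunit`, the census's "`λ^an = 1, μ^an = 0`"), the period index `ϖ`
(`ϖ·Ω_E = Ω_f⁺`) with `ord_p ϖ ≤ 0`, non-anomalous reduction (`ℓ_p = 1`), `#Ш_an = s`. Proof: the
HEADLINE `missingLowerBoundAt_rankOne_of_tameBranchRatDvdAt_of_tameBranchPAdicGrossZagier` with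
`hBcl`, `hGZ` := the `Prop`'s datum and `hA` := Theorem (A). Nothing booked; no upper half here.
[cite: Delbourgo2002, Theorem (A), (B), (C) (p. 40)] [cite: Miller2011LMS, Def. 1.1] -/
theorem missingLowerBoundAt_rankOne_gordHigher_of_cellFact_of_thmC_of_cert
    (hFact2 : tameBranch_delbourgoDatum_rankOne_leadingTerms)
    (hC : Delbourgo2002.thmC_charIdeal_dvd_tameBranch) (hDel : Delbourgo2002.mainTheorem)
    (hDelM : Delbourgo2002.mainTheorem_potMult) (hGZK : rank_eq_analyticRank_of_analyticRank_le_one)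
    (hp5 : 5 ≤ p) (hcm : ¬ W.HasCM) (hadd : Addv W p) (hG : TypeGOrd W p)
    (he : semistabilityIndex W p ≠ 2) (hr : W.analyticRank = 1) (hna : ReductionNonAnomalous W p)
    {N : ℕ} [NeZero N] {f : CuspForm (Gamma0 N) 2} {ε : DirichletCharacter ℂ_[p] p} {α : ℚ_[p]}
    {B : PowerSeries ℚ_[p]}
    (hf : IsNewformOf W f) (hε : orderOf ε = tameDefect W p) (hα : ‖α‖ = 1)
    (hB : IsTameBranchOf f p ε α B) (hint : ∀ j : ℕ, ‖PowerSeries.coeff j B‖ ≤ 1)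
    (hunit : ‖PowerSeries.coeff 1 B‖ = 1)
    (ϖ : ℚ) (hϖ : (ϖ : ℝ) * W.realPeriodRat = plusPeriod f) (hϖv : padicValRat p ϖ ≤ 0)
    {s : ℚ} (hs : shaAn W = (s : ℂ)) :
    MissingLowerBoundAt W p := by
  have hp2 : p ≠ 2 := by omega
  obtain ⟨Dh, hBcl, hGZ⟩ := hFact2 W p hp5 hcm hadd hG he hr
  exact missingLowerBoundAt_rankOne_of_tameBranchRatDvdAt_of_tameBranchPAdicGrossZagier
    (tameBranchRatDvdAt_of_thmC hC hDel hDelM hp5 hcm) hp2 hadd (Or.inr hG) hf hε hα hB hint hunit ϖ hϖ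
    hϖv hBcl hGZ (fun κ γ hκ hγ D ↦ hDel.isTorsion hp5 hcm hadd hG hκ hγ D) hGZK hr hna hs

/-- **X4♯(G-ord) class form** (`E[p]` irreducible; defect `3,4,6`, `p ≥ 5`, non-CM, `r_an = 1`,
non-anomalous): `MissingLowerBoundAt W p` from print + the `Prop` + one certified tame branch. X4♯(G-ord)
stays CONSTRUCTION-SHAPED; nothing booked. [cite: Delbourgo2002, Theorem (A), (B), (C) (p. 40)]
[cite: Miller2011LMS, Def. 1.1] -/
theorem ClassX4Gord.missingLowerBoundAt_rankOne_higher_of_cellFact_of_thmC_of_cert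
    (hFact2 : tameBranch_delbourgoDatum_rankOne_leadingTerms)
    (hC : Delbourgo2002.thmC_charIdeal_dvd_tameBranch) (hDel : Delbourgo2002.mainTheorem)
    (hDelM : Delbourgo2002.mainTheorem_potMult) (hGZK : rank_eq_analyticRank_of_analyticRank_le_one)
    (hX : ClassX4Gord W p) (hp5 : 5 ≤ p) (hcm : ¬ W.HasCM) (he : semistabilityIndex W p ≠ 2)
    (hr : W.analyticRank = 1) (hna : ReductionNonAnomalous W p)
    {N : ℕ} [NeZero N] {f : CuspForm (Gamma0 N) 2} {ε : DirichletCharacter ℂ_[p] p} {α : ℚ_[p]}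
    {B : PowerSeries ℚ_[p]}
    (hf : IsNewformOf W f) (hε : orderOf ε = tameDefect W p) (hα : ‖α‖ = 1)
    (hB : IsTameBranchOf f p ε α B) (hint : ∀ j : ℕ, ‖PowerSeries.coeff j B‖ ≤ 1)
    (hunit : ‖PowerSeries.coeff 1 B‖ = 1)
    (ϖ : ℚ) (hϖ : (ϖ : ℝ) * W.realPeriodRat = plusPeriod f) (hϖv : padicValRat p ϖ ≤ 0)
    {s : ℚ} (hs : shaAn W = (s : ℂ)) :
    MissingLowerBoundAt W p :=
  missingLowerBoundAt_rankOne_gordHigher_of_cellFact_of_thmC_of_cert hFact2 hC hDel hDelM hGZK hp5 hcm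
    hX.addv.2 hX.typeGOrd he hr hna hf hε hα hB hint hunit ϖ hϖ hϖv hs

/-- **X3♯(G-ord) class form** (`E[p]` reducible; defect `3,4,6`, `p ≥ 5`, non-CM, `r_an = 1`,
non-anomalous): `MissingLowerBoundAt W p` from print + the `Prop` + one certified tame branch. X3♯(G-ord)
stays CONSTRUCTION-SHAPED; nothing booked. [cite: Delbourgo2002, Theorem (A), (B), (C) (p. 40)]
[cite: Miller2011LMS, Def. 1.1] -/
theorem ClassX3Gord.missingLowerBoundAt_rankOne_higher_of_cellFact_of_thmC_of_cert
    (hFact2 : tameBranch_delbourgoDatum_rankOne_leadingTerms)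
    (hC : Delbourgo2002.thmC_charIdeal_dvd_tameBranch) (hDel : Delbourgo2002.mainTheorem)
    (hDelM : Delbourgo2002.mainTheorem_potMult) (hGZK : rank_eq_analyticRank_of_analyticRank_le_one)
    (hX : ClassX3Gord W p) (hp5 : 5 ≤ p) (hcm : ¬ W.HasCM) (he : semistabilityIndex W p ≠ 2)
    (hr : W.analyticRank = 1) (hna : ReductionNonAnomalous W p)
    {N : ℕ} [NeZero N] {f : CuspForm (Gamma0 N) 2} {ε : DirichletCharacter ℂ_[p] p} {α : ℚ_[p]}
    {B : PowerSeries ℚ_[p]}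
    (hf : IsNewformOf W f) (hε : orderOf ε = tameDefect W p) (hα : ‖α‖ = 1)
    (hB : IsTameBranchOf f p ε α B) (hint : ∀ j : ℕ, ‖PowerSeries.coeff j B‖ ≤ 1)
    (hunit : ‖PowerSeries.coeff 1 B‖ = 1)
    (ϖ : ℚ) (hϖ : (ϖ : ℝ) * W.realPeriodRat = plusPeriod f) (hϖv : padicValRat p ϖ ≤ 0)
    {s : ℚ} (hs : shaAn W = (s : ℂ)) :
    MissingLowerBoundAt W p :=
  missingLowerBoundAt_rankOne_gordHigher_of_cellFact_of_thmC_of_cert hFact2 hC hDel hDelM hGZK hp5 hcm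
    hX.addv hX.typeGOrd he hr hna hf hε hα hB hint hunit ϖ hϖ hϖv hs

/-- **The Schneider dictionary for the cell `Prop`'s datum** (PROOF-gz2 Cor. 3′ (a)): on the same
locus, for the datum delivered by `hFact2` and ANY tame-branch tuple, `Reg_p(E,Dh) ≠ 0 ⟺ [T¹]B ≠ 0` —
so the analytic non-vanishing of the linear coefficient IS Schneider's conjecture for Delbourgo's
`⟨,⟩_{p,ℚ}` at the pair (by `schneiderConjecture_iff_coeff_one_ne_zero_of_tameBranchPAdicGrossZagier`).
[cite: Delbourgo1998, §2.5 BS-D(p) (i), (ii) (pp. 151–152)] -/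
theorem exists_datum_schneider_iff_coeff_one_ne_zero_of_cellFact
    (hFact2 : tameBranch_delbourgoDatum_rankOne_leadingTerms) (hmod : hasEntireLFunction_rat)
    (hGZK : rank_eq_analyticRank_of_analyticRank_le_one)
    (hp5 : 5 ≤ p) (hcm : ¬ W.HasCM) (hadd : Addv W p) (hG : TypeGOrd W p)
    (he : semistabilityIndex W p ≠ 2) (hr : W.analyticRank = 1)
    {N : ℕ} [NeZero N] {f : CuspForm (Gamma0 N) 2} {ε : DirichletCharacter ℂ_[p] p} {α : ℚ_[p]}
    {B : PowerSeries ℚ_[p]} (hf : IsNewformOf W f) (hε : orderOf ε = tameDefect W p) (hα : ‖α‖ = 1)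
    (hB : IsTameBranchOf f p ε α B) (ϖ : ℚ) (hϖ : (ϖ : ℝ) * W.realPeriodRat = plusPeriod f) :
    ∃ Dh : PAdicHeightData W p, LeadingTermClauses W p Dh ∧ TameBranchPAdicGrossZagierAt W p Dh ∧
      (SchneiderConjecture Dh ↔ PowerSeries.coeff 1 B ≠ 0) := by
  have hp2 : p ≠ 2 := by omega
  obtain ⟨Dh, hBcl, hGZ⟩ := hFact2 W p hp5 hcm hadd hG he hr
  exact ⟨Dh, hBcl, hGZ, schneiderConjecture_iff_coeff_one_ne_zero_of_tameBranchPAdicGrossZagier hp2 hmod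
    hGZK hr hGZ hf hε hα hB ϖ hϖ⟩

end Summit.BirchSwinnertonDyer.Rank1Residual.Additive

end
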